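import Literature.RepresentationTheory.VerySimpleRepresentations
import Mathlib.RepresentationTheory.Irreducible
import Mathlib.RingTheory.SimpleModule.Isotypic
import Mathlib.RingTheory.Artinian.Module
import Mathlib.LinearAlgebra.Dimension.Finite
import HarnessLib

/-!
# Clifford theory for a `G`-normal subalgebra: an irreducible `G`-module is a semisimple `R`-module whose isotypic components `G` permutes transitively (Dolgachev–Zarhin, proof of Theorem 2.21, Steps 1–2)

Topic `Literature/RepresentationTheory`, namespace `Literature.RepresentationTheory`; lane `lit-hodgefound`
(Track 2 foundations library), row g8-#2 «(g8-#1)⁺ — Clifford theory for `G`-normal subalgebras» of seat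
p11 (gen 8); sequel of `Literature/RepresentationTheory/VerySimpleRepresentations.lean` (Zarhin's
`IsNormalSubalgebra`, `IsVerySimple`). Plumbing definitions with bodies: `IsNormalSubalgebra.conjSubmodule`
(the `R`-submodule `sU`), `IsNormalSubalgebra.conjOrderIso` (`U ↦ sU` as an automorphism of the lattice of
`R`-submodules), `IsNormalSubalgebra.conjSubmoduleCongr` (`U ≅ U' ⇒ sU ≅ sU'`),
`IsNormalSubalgebra.iSupConjSubrepresentation` (`Σ_s sU` as a subrepresentation) and
`IsNormalSubalgebra.isotypicComponentsPerm` ("the homomorphism `G → 𝐒_r`" permuting the isotypic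
components); everything else is a THEOREM. No named fact (net debt 0). Mathlib only.

## Source READ (held text), verbatim

I. Dolgachev, Yu. G. Zarhin, *Endomorphisms of Complex Abelian Varieties* (notes dated 31 July 2024; bib
`DolgachevZarhin2024`; held text `paper:galaxy-pdf-8712177384607648460`), §2.3 "Permutational
representations", proof of Theorem 2.21 (very simplicity of the `𝔄_n`-module `(𝔽_ℓ^𝔅)^0`), p0039 L15–L25
and p0040 L1–L9:

"Let `R ⊂ End_{𝔽_ℓ}(𝒱)` be a `G`-normal subalgebra. Clearly, `𝒱` is a faithful `R`-module.
Step 1. `𝒱` is a semisimple `R`-module. Indeed, let `U ⊂ V` be a simple `R`-submodule. Then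
`U' = Σ_{s ∈ G} sU` is a non-zero `G`-stable subspace in `𝒱` and therefore must coincide with `𝒱`. On the
other hand, each `sU` is also a `R`-submodule in `𝒱`, because `s⁻¹Rs = R`. Moreover, since
`Rs⁻¹W = s⁻¹sRs⁻¹W = s⁻¹RW = s⁻¹W`, if `W ⊂ sU` is an `R`-submodule, then `s⁻¹W` is an `R`-submodule in
`U` […]. Since `U` is simple, `s⁻¹W = {0}` or `U`. This implies that `sU` is also simple. Hence `𝒱 = U'`
is a sum of simple `R`-modules and therefore is a semisimple `R`-module.
**Step 2**. The `R`-module `𝒱` is *isotypic*. Indeed, let us split the semisimple `R`-module `𝒱` into the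
direct sum `𝒱 = 𝒱_1 ⊕ ⋯ ⊕ 𝒱_r` of its isotypic components. Dimension arguments imply that
`r ≤ dim(𝒱) = n − 1`. It follows easily from the arguments of the previous step that for each isotypic
component `𝒱_i`, for each `s ∈ G`, its image `s𝒱_i` is an isotypic `R`-submodule. Therefore, it is
contained in some `𝒱_j`. Similarly, `s⁻¹𝒱_j` is an isotypic submodule obviously containing `𝒱_i`. Since
`𝒱_i` is the isotypic component, `s⁻¹𝒱_j = 𝒱_i`, and therefore, `s𝒱_i = 𝒱_j`. This means that `s`
permutes the `𝒱_i`; since `𝒱` is simple `G`-module, `G` permutes them transitively. This gives rise to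
the homomorphism `G → 𝐒_r`. Since `G` is a simple group, whose order (`= n!/2`) is greater than
`(n − 1)! ≥ r! =` order of `𝐒_r`, this homomorphism must be trivial. This means that `s𝒱_i = 𝒱_i` for
all `s ∈ G`, and `𝒱 = 𝒱_i` is isotypic."

## What is here — the group-independent content of Steps 1–2, for every group `G` and field `k`

Throughout: `ρ : Representation k G V`, `R : Subalgebra k (Module.End k V)` with
`h : IsNormalSubalgebra ρ R` (Definition 2.1, FILE `VerySimpleRepresentations`), and `V` viewed as an
`R`-module through `R ⊂ End_k(V)` (Mathlib's `Subalgebra.moduleLeft` over `Module.End.applyModule`: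
`r • v = r v`). "Clearly, `𝒱` is a faithful `R`-module" is Mathlib's instance `FaithfulSMul R V` and is
not restated.

* §1 (`k` any commutative ring) `sU`: `h.conjSubmodule s U = {v | ρ(s⁻¹) v ∈ U} = ρ(s) '' U` is an
  `R`-submodule ("because `s⁻¹Rs = R`"); `1U = U`, `(st)U = s(tU)`; so `U ↦ sU` is an automorphism of
  the lattice of `R`-submodules (`h.conjOrderIso s`, inverse `s⁻¹`), hence "`sU` is also simple"
  (`isSimpleModule_conjSubmodule_iff` — the printed sub-argument about `W ⊂ sU` is precisely the
  statement that a lattice automorphism preserves atoms) and `s(⨆ U_i) = ⨆ sU_i`.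
* §2 "`U' = Σ_s sU` is `G`-stable": `ρ(g) U' = U'` (`conjSubmodule_iSup_conjSubmodule`), packaged as the
  subrepresentation `h.iSupConjSubrepresentation U` of `ρ` (Mathlib `Subrepresentation`); for `ρ`
  irreducible and `U ≠ 0`, "`U'` must coincide with `𝒱`" (`iSup_conjSubmodule_eq_top`).
* §3 transport of isomorphism types: an `R`-isomorphism `e : U ≅ U'` gives `sU ≅ sU'`,
  `v ↦ s e(s⁻¹ v)` (`conjSubmoduleCongr`); hence `s` carries the isotypic component of type `S` onto the
  isotypic component of type `sS` (`conjSubmodule_isotypicComponent`; Mathlib `isotypicComponent`) and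
  permutes the set `isotypicComponents R V` (`conjSubmodule_mem_isotypicComponents`), giving "the
  homomorphism `G → 𝐒_r`" `h.isotypicComponentsPerm : G →* Equiv.Perm (isotypicComponents R V)`.
  DEVIATION (shorter road, recorded): the printed "`s𝒱_i` is isotypic, hence inside some `𝒱_j`;
  `s⁻¹𝒱_j ⊇ 𝒱_i`; hence `s𝒱_i = 𝒱_j`" is replaced by transporting the defining supremum
  `𝒱_S = Σ {m | m ≅ S}` along the lattice automorphism of §1 — same conclusion `s𝒱_i = 𝒱_j`, valid
  without semisimplicity.
* §4 (`k` a field, `ρ` irreducible = Mathlib `Representation.IsIrreducible`: the lattice of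
  subrepresentations is `{0, V}`, `V ≠ 0`) **Step 1** (`isSemisimpleModule_of_isIrreducible`, `V`
  finite-dimensional): `V` is a semisimple `R`-module; a simple `R`-submodule exists because `V ≠ 0` is
  Artinian over `k ⊂ R`. **Step 2**: `G` permutes the isotypic components transitively
  (`exists_conjSubmodule_eq`, `isotypicComponentsPerm_transitive`; via the independence of the isotypic
  components, Mathlib `sSupIndep_isotypicComponents`); "Dimension arguments imply that `r ≤ dim(𝒱)`"
  (`natCard_isotypicComponents_le_finrank`: the components are independent non-zero `k`-subspaces); "if
  `s𝒱_i = 𝒱_i` for all `s ∈ G` then `𝒱 = 𝒱_i` is isotypic" (`isIsotypic_of_forall_conjSubmodule_eq`,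
  `isIsotypic_of_isotypicComponentsPerm_eq_one`; Mathlib `IsIsotypic R V`); assembled in the form the
  text uses it: if every homomorphism `G → 𝐒_r` with `r ≤ dim_k V` is trivial, then the `R`-module `V`
  is isotypic (`isIsotypic_of_forall_perm_hom_eq_one`).

Not here: the `𝔄_n`-specific inputs and Steps 3–4 of the proof (absolute simplicity of `(𝔽_ℓ^𝔅)^0`,
simplicity and order of `𝔄_n`, `End_R(𝒱) ≅ Mat_d(F)`, projective representations) — the
classification-sized part of Theorem 2.21. Related, distinct tree result: the classical Clifford theorem
for the group algebra of a normal SUBGROUP, `k[N] ⊂ k[G]`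
(`Literature.RepresentationTheory.Semisimple.Representation.isSemisimpleRepresentation_restrictSubgroup`,
file `Semisimple/CliffordRestriction.lean`, `k[N]`-submodules of `V|_N`); here `R` is an arbitrary
`G`-normal subalgebra of `End_k(V)` (the image of `k[N]` is one, `isNormalSubalgebra_adjoin_image_of_normal`
of FILE `VerySimpleRepresentations`) and the new content is Step 2.

## References

* [DolgachevZarhin2024] I. Dolgachev, Yu. G. Zarhin, *Endomorphisms of Complex Abelian Varieties* (2024),
  §2.3, proof of Theorem 2.21, Steps 1–2 (held text p0039 L15–L25, p0040 L1–L9).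
-/

namespace Literature.RepresentationTheory

open Module

namespace IsNormalSubalgebra

section CommRing

variable {k : Type*} [CommRing k] {G : Type*} [Group G] {V : Type*} [AddCommGroup V] [Module k V]
variable {ρ : Representation k G V} {R : Subalgebra k (Module.End k V)}

/-! ### §1 The conjugate `sU` of an `R`-submodule `U` -/

/-- **`sU`** (proof of Theorem 2.21, Step 1: "each `sU` is also a `R`-submodule in `𝒱`, because
`s⁻¹Rs = R`"): for a `G`-normal `R ⊂ End_k(V)`, `s ∈ G` and an `R`-submodule `U ⊂ V` (`V` an `R`-module
through `R ⊂ End_k(V)`), the `R`-submodule `sU = ρ(s)(U) = {v | ρ(s⁻¹) v ∈ U}`; it is closed under `R`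
because `ρ(s⁻¹)(r v) = (ρ(s⁻¹) r ρ(s⁻¹)⁻¹)(ρ(s⁻¹) v)` with `ρ(s⁻¹) r ρ(s⁻¹)⁻¹ ∈ R`.
[cite: DolgachevZarhin2024, §2.3 proof of Theorem 2.21, Step 1] -/
def conjSubmodule (h : IsNormalSubalgebra ρ R) (s : G) (U : Submodule R V) : Submodule R V where
  carrier := {v | ρ s⁻¹ v ∈ U}
  zero_mem' := by simp
  add_mem' {v w} hv hw := by
    simp only [Set.mem_setOf_eq, map_add] at hv hw ⊢
    exact U.add_mem hv hw
  smul_mem' r {v} hv := by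
    simp only [Set.mem_setOf_eq] at hv ⊢
    have hr : ρ s⁻¹ * (r : Module.End k V) * ρ s⁻¹⁻¹ ∈ R := h.conj_mem s⁻¹ r.2
    have key : ρ s⁻¹ ((r : Module.End k V) v) = (⟨_, hr⟩ : R) • ρ s⁻¹ v := by
      change _ = (ρ s⁻¹ * (r : Module.End k V) * ρ s⁻¹⁻¹) (ρ s⁻¹ v)
      rw [inv_inv, Module.End.mul_apply, Module.End.mul_apply, Representation.self_inv_apply]
    change ρ s⁻¹ ((r : Module.End k V) v) ∈ U
    rw [key]
    exact U.smul_mem _ hv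

/-- Membership in `sU`: `v ∈ sU ↔ ρ(s⁻¹) v ∈ U`. [cite: DolgachevZarhin2024, §2.3 proof of Theorem 2.21, Step 1] -/
@[simp] theorem mem_conjSubmodule_iff (h : IsNormalSubalgebra ρ R) {s : G} {U : Submodule R V} {v : V} :
    v ∈ h.conjSubmodule s U ↔ ρ s⁻¹ v ∈ U := Iff.rfl

/-- `ρ(s) v ∈ sU ↔ v ∈ U`. [cite: DolgachevZarhin2024, §2.3 proof of Theorem 2.21, Step 1] -/
theorem apply_mem_conjSubmodule_iff (h : IsNormalSubalgebra ρ R) {s : G} {U : Submodule R V} {v : V} :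
    ρ s v ∈ h.conjSubmodule s U ↔ v ∈ U := by
  rw [mem_conjSubmodule_iff, Representation.inv_self_apply]

/-- `sU` is the image `ρ(s)(U)`. [cite: DolgachevZarhin2024, §2.3 proof of Theorem 2.21, Step 1] -/
theorem coe_conjSubmodule (h : IsNormalSubalgebra ρ R) (s : G) (U : Submodule R V) :
    (h.conjSubmodule s U : Set V) = ρ s '' (U : Set V) := by
  ext v
  refine ⟨fun hv ↦ ⟨ρ s⁻¹ v, hv, ρ.self_inv_apply s v⟩, ?_⟩
  rintro ⟨u, hu, rfl⟩
  exact h.apply_mem_conjSubmodule_iff.2 hu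

/-- `1U = U`. [cite: DolgachevZarhin2024, §2.3 proof of Theorem 2.21, Step 1] -/
@[simp] theorem conjSubmodule_one (h : IsNormalSubalgebra ρ R) (U : Submodule R V) :
    h.conjSubmodule 1 U = U := by
  ext v
  simp [mem_conjSubmodule_iff]

/-- `(st)U = s(tU)`. [cite: DolgachevZarhin2024, §2.3 proof of Theorem 2.21, Step 1] -/
theorem conjSubmodule_mul (h : IsNormalSubalgebra ρ R) (s t : G) (U : Submodule R V) :
    h.conjSubmodule (s * t) U = h.conjSubmodule s (h.conjSubmodule t U) := by
  ext v
  simp only [mem_conjSubmodule_iff, mul_inv_rev, map_mul, Module.End.mul_apply]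

/-- `U ⊆ U' ⇒ sU ⊆ sU'`. [cite: DolgachevZarhin2024, §2.3 proof of Theorem 2.21, Step 1] -/
theorem conjSubmodule_mono (h : IsNormalSubalgebra ρ R) (s : G) : Monotone (h.conjSubmodule s) :=
  fun _ _ hle _ hv ↦ hle hv

/-- `s⁻¹(sU) = U`. [cite: DolgachevZarhin2024, §2.3 proof of Theorem 2.21, Step 1] -/
@[simp] theorem conjSubmodule_inv_conjSubmodule (h : IsNormalSubalgebra ρ R) (s : G) (U : Submodule R V) :
    h.conjSubmodule s⁻¹ (h.conjSubmodule s U) = U := by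
  rw [← conjSubmodule_mul, inv_mul_cancel, conjSubmodule_one]

/-- `s(s⁻¹U) = U`. [cite: DolgachevZarhin2024, §2.3 proof of Theorem 2.21, Step 1] -/
@[simp] theorem conjSubmodule_conjSubmodule_inv (h : IsNormalSubalgebra ρ R) (s : G) (U : Submodule R V) :
    h.conjSubmodule s (h.conjSubmodule s⁻¹ U) = U := by
  rw [← conjSubmodule_mul, mul_inv_cancel, conjSubmodule_one]

/-- **`U ↦ sU` is an automorphism of the lattice of `R`-submodules of `V`** (inverse `U ↦ s⁻¹U`) — the
content of "if `W ⊂ sU` is an `R`-submodule, then `s⁻¹W` is an `R`-submodule in `U`".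
[cite: DolgachevZarhin2024, §2.3 proof of Theorem 2.21, Step 1] -/
def conjOrderIso (h : IsNormalSubalgebra ρ R) (s : G) : Submodule R V ≃o Submodule R V where
  toFun := h.conjSubmodule s
  invFun := h.conjSubmodule s⁻¹
  left_inv := h.conjSubmodule_inv_conjSubmodule s
  right_inv := h.conjSubmodule_conjSubmodule_inv s
  map_rel_iff' {U U'} := by
    change h.conjSubmodule s U ≤ h.conjSubmodule s U' ↔ U ≤ U'
    refine ⟨fun hle ↦ ?_, fun hle ↦ h.conjSubmodule_mono s hle⟩
    have hle' := h.conjSubmodule_mono s⁻¹ hle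
    rwa [conjSubmodule_inv_conjSubmodule, conjSubmodule_inv_conjSubmodule] at hle'

/-- Unfolding of `conjOrderIso`. [cite: DolgachevZarhin2024, §2.3 proof of Theorem 2.21, Step 1] -/
@[simp] theorem conjOrderIso_apply (h : IsNormalSubalgebra ρ R) (s : G) (U : Submodule R V) :
    h.conjOrderIso s U = h.conjSubmodule s U := rfl

/-- The inverse of `conjOrderIso s` is conjugation by `s⁻¹`.
[cite: DolgachevZarhin2024, §2.3 proof of Theorem 2.21, Step 1] -/
@[simp] theorem conjOrderIso_symm_apply (h : IsNormalSubalgebra ρ R) (s : G) (U : Submodule R V) :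
    (h.conjOrderIso s).symm U = h.conjSubmodule s⁻¹ U := rfl

/-- `s(⨆ U_i) = ⨆ sU_i`. [cite: DolgachevZarhin2024, §2.3 proof of Theorem 2.21, Step 1] -/
theorem conjSubmodule_iSup (h : IsNormalSubalgebra ρ R) (s : G) {ι : Sort*} (U : ι → Submodule R V) :
    h.conjSubmodule s (⨆ i, U i) = ⨆ i, h.conjSubmodule s (U i) :=
  (h.conjOrderIso s).map_iSup U

/-- `s0 = 0`. [cite: DolgachevZarhin2024, §2.3 proof of Theorem 2.21, Step 1] -/
@[simp] theorem conjSubmodule_bot (h : IsNormalSubalgebra ρ R) (s : G) :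
    h.conjSubmodule s (⊥ : Submodule R V) = ⊥ :=
  (h.conjOrderIso s).map_bot

/-- `sV = V`. [cite: DolgachevZarhin2024, §2.3 proof of Theorem 2.21, Step 1] -/
@[simp] theorem conjSubmodule_top (h : IsNormalSubalgebra ρ R) (s : G) :
    h.conjSubmodule s (⊤ : Submodule R V) = ⊤ :=
  (h.conjOrderIso s).map_top

/-- `sU = 0 ↔ U = 0`. [cite: DolgachevZarhin2024, §2.3 proof of Theorem 2.21, Step 1] -/
theorem conjSubmodule_eq_bot_iff (h : IsNormalSubalgebra ρ R) (s : G) (U : Submodule R V) :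
    h.conjSubmodule s U = ⊥ ↔ U = ⊥ := by
  refine ⟨fun hU ↦ ?_, fun hU ↦ by rw [hU, conjSubmodule_bot]⟩
  rw [← h.conjSubmodule_inv_conjSubmodule s U, hU, conjSubmodule_bot]

/-- "This implies that `sU` is also simple": `sU` is a simple `R`-module iff `U` is (a lattice
automorphism preserves atoms). [cite: DolgachevZarhin2024, §2.3 proof of Theorem 2.21, Step 1] -/
theorem isSimpleModule_conjSubmodule_iff (h : IsNormalSubalgebra ρ R) (s : G) (U : Submodule R V) :
    IsSimpleModule R (h.conjSubmodule s U) ↔ IsSimpleModule R U := by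
  rw [isSimpleModule_iff_isAtom, isSimpleModule_iff_isAtom, ← conjOrderIso_apply, OrderIso.isAtom_iff]

/-! ### §2 `U' = Σ_s sU` is `G`-stable -/

/-- `ρ(g) (Σ_s sU) = Σ_s sU`. [cite: DolgachevZarhin2024, §2.3 proof of Theorem 2.21, Step 1] -/
theorem conjSubmodule_iSup_conjSubmodule (h : IsNormalSubalgebra ρ R) (g : G) (U : Submodule R V) :
    h.conjSubmodule g (⨆ s, h.conjSubmodule s U) = ⨆ s, h.conjSubmodule s U := by
  rw [conjSubmodule_iSup]
  simp only [← conjSubmodule_mul]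
  exact (Group.mulLeft_bijective g).surjective.iSup_comp fun s ↦ h.conjSubmodule s U

/-- "`U' = Σ_{s ∈ G} sU` is a `G`-stable subspace": `ρ(g) v ∈ U' ↔ v ∈ U'`.
[cite: DolgachevZarhin2024, §2.3 proof of Theorem 2.21, Step 1] -/
theorem apply_mem_iSup_conjSubmodule_iff (h : IsNormalSubalgebra ρ R) (g : G) (U : Submodule R V) {v : V} :
    ρ g v ∈ ⨆ s, h.conjSubmodule s U ↔ v ∈ ⨆ s, h.conjSubmodule s U := by
  conv_lhs => rw [← h.conjSubmodule_iSup_conjSubmodule g U]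
  exact h.apply_mem_conjSubmodule_iff

/-- `U = 1U ⊆ Σ_s sU`. [cite: DolgachevZarhin2024, §2.3 proof of Theorem 2.21, Step 1] -/
theorem le_iSup_conjSubmodule (h : IsNormalSubalgebra ρ R) (U : Submodule R V) :
    U ≤ ⨆ s, h.conjSubmodule s U := by
  conv_lhs => rw [← h.conjSubmodule_one U]
  exact le_iSup (fun s ↦ h.conjSubmodule s U) 1

/-- `U' = Σ_s sU` as a **subrepresentation** of `ρ` (its `k`-subspace is `U'` with the `R`-action
forgotten along `k ⊂ R`). [cite: DolgachevZarhin2024, §2.3 proof of Theorem 2.21, Step 1] -/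
def iSupConjSubrepresentation (h : IsNormalSubalgebra ρ R) (U : Submodule R V) : Subrepresentation ρ where
  toSubmodule := (⨆ s, h.conjSubmodule s U).restrictScalars k
  apply_mem_toSubmodule g _ hv := (h.apply_mem_iSup_conjSubmodule_iff g U).2 hv

/-- Unfolding of `iSupConjSubrepresentation`. [cite: DolgachevZarhin2024, §2.3 proof of Theorem 2.21, Step 1] -/
@[simp] theorem iSupConjSubrepresentation_toSubmodule (h : IsNormalSubalgebra ρ R) (U : Submodule R V) :
    (h.iSupConjSubrepresentation U).toSubmodule = (⨆ s, h.conjSubmodule s U).restrictScalars k := rfl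

/-! ### §3 `s` transports isomorphism types and permutes the isotypic components -/

/-- `u ↦ ρ(s) u : U → sU`. [folklore] -/
private def toConj (h : IsNormalSubalgebra ρ R) (s : G) (U : Submodule R V) (u : U) :
    h.conjSubmodule s U :=
  ⟨ρ s u, h.apply_mem_conjSubmodule_iff.2 u.2⟩

/-- `v ↦ ρ(s⁻¹) v : sU → U`. [folklore] -/
private def ofConj (h : IsNormalSubalgebra ρ R) (s : G) (U : Submodule R V) (v : h.conjSubmodule s U) : U :=
  ⟨ρ s⁻¹ v, v.2⟩

/-- `ρ(s⁻¹)(ρ(s) u) = u`. [folklore] -/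
private theorem ofConj_toConj (h : IsNormalSubalgebra ρ R) (s : G) (U : Submodule R V) (u : U) :
    ofConj h s U (toConj h s U u) = u :=
  Subtype.ext (ρ.inv_self_apply s u)

/-- `ρ(s)(ρ(s⁻¹) v) = v`. [folklore] -/
private theorem toConj_ofConj (h : IsNormalSubalgebra ρ R) (s : G) (U : Submodule R V)
    (v : h.conjSubmodule s U) : toConj h s U (ofConj h s U v) = v :=
  Subtype.ext (ρ.self_inv_apply s v)

/-- Additivity of `u ↦ ρ(s) u`. [folklore] -/
private theorem toConj_add (h : IsNormalSubalgebra ρ R) (s : G) (U : Submodule R V) (u u' : U) :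
    toConj h s U (u + u') = toConj h s U u + toConj h s U u' :=
  Subtype.ext (map_add (ρ s) (u : V) (u' : V))

/-- Additivity of `v ↦ ρ(s⁻¹) v`. [folklore] -/
private theorem ofConj_add (h : IsNormalSubalgebra ρ R) (s : G) (U : Submodule R V)
    (v v' : h.conjSubmodule s U) : ofConj h s U (v + v') = ofConj h s U v + ofConj h s U v' :=
  Subtype.ext (map_add (ρ s⁻¹) (v : V) (v' : V))

/-- The element `s⁻¹ r s = ρ(s⁻¹) r ρ(s⁻¹)⁻¹ ∈ R` of a normal `R`. [folklore] -/
private def conjElt (h : IsNormalSubalgebra ρ R) (s : G) (r : R) : R :=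
  ⟨ρ s⁻¹ * (r : Module.End k V) * ρ s⁻¹⁻¹, h.conj_mem s⁻¹ r.2⟩

/-- `ρ(s⁻¹)(r v) = (s⁻¹ r s)(ρ(s⁻¹) v)` ("`Rs⁻¹W = s⁻¹sRs⁻¹W = s⁻¹RW`"). [folklore] -/
private theorem ofConj_smul (h : IsNormalSubalgebra ρ R) (s : G) (U : Submodule R V) (r : R)
    (v : h.conjSubmodule s U) : ofConj h s U (r • v) = conjElt h s r • ofConj h s U v := by
  apply Subtype.ext
  change ρ s⁻¹ ((r : Module.End k V) v) = (ρ s⁻¹ * (r : Module.End k V) * ρ s⁻¹⁻¹) (ρ s⁻¹ v)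
  rw [inv_inv, Module.End.mul_apply, Module.End.mul_apply, Representation.self_inv_apply]

/-- `ρ(s)((s⁻¹ r s) u) = r (ρ(s) u)`. [folklore] -/
private theorem toConj_smul (h : IsNormalSubalgebra ρ R) (s : G) (U : Submodule R V) (r : R) (u : U) :
    toConj h s U (conjElt h s r • u) = r • toConj h s U u := by
  apply Subtype.ext
  change ρ s ((ρ s⁻¹ * (r : Module.End k V) * ρ s⁻¹⁻¹) u) = (r : Module.End k V) (ρ s u)
  rw [inv_inv, Module.End.mul_apply, Module.End.mul_apply, Representation.self_inv_apply]

/-- **Transport of isomorphism types along `s`** ("it follows easily from the arguments of the previous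
step that … `s𝒱_i` is an isotypic `R`-submodule"): an `R`-isomorphism `e : U ≅ U'` yields the
`R`-isomorphism `sU ≅ sU'`, `v ↦ ρ(s) e(ρ(s⁻¹) v)` — it is `R`-linear because
`ρ(s⁻¹) r = (s⁻¹ r s) ρ(s⁻¹)` and `ρ(s) (s⁻¹ r s) = r ρ(s)` with `s⁻¹ r s ∈ R`.
[cite: DolgachevZarhin2024, §2.3 proof of Theorem 2.21, Step 2] -/
def conjSubmoduleCongr (h : IsNormalSubalgebra ρ R) (s : G) {U U' : Submodule R V} (e : U ≃ₗ[R] U') :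
    h.conjSubmodule s U ≃ₗ[R] h.conjSubmodule s U' where
  toFun v := toConj h s U' (e (ofConj h s U v))
  invFun w := toConj h s U (e.symm (ofConj h s U' w))
  map_add' v w := by simp only [ofConj_add, map_add, toConj_add]
  map_smul' r v := by simp only [ofConj_smul, map_smul, toConj_smul, RingHom.id_apply]
  left_inv v := by simp only [ofConj_toConj, LinearEquiv.symm_apply_apply, toConj_ofConj]
  right_inv w := by simp only [ofConj_toConj, LinearEquiv.apply_symm_apply, toConj_ofConj]

/-- The underlying map of `conjSubmoduleCongr`: `v ↦ ρ(s) e(ρ(s⁻¹) v)`.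
[cite: DolgachevZarhin2024, §2.3 proof of Theorem 2.21, Step 2] -/
theorem coe_conjSubmoduleCongr_apply (h : IsNormalSubalgebra ρ R) (s : G) {U U' : Submodule R V}
    (e : U ≃ₗ[R] U') (v : h.conjSubmodule s U) :
    ((h.conjSubmoduleCongr s e v : h.conjSubmodule s U') : V) = ρ s (e ⟨ρ s⁻¹ v, v.2⟩ : U') := rfl

/-- **`s` carries the isotypic component of type `S` onto the isotypic component of type `sS`**:
`s(Σ {m | m ≅ S}) = Σ {m' | m' ≅ sS}` (`m ≅ S ⇒ sm ≅ sS`, and `m' ≅ sS ⇒ s⁻¹m' ≅ s⁻¹sS = S`).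
[cite: DolgachevZarhin2024, §2.3 proof of Theorem 2.21, Step 2] -/
theorem conjSubmodule_isotypicComponent (h : IsNormalSubalgebra ρ R) (s : G) (S : Submodule R V) :
    h.conjSubmodule s (isotypicComponent R V S) = isotypicComponent R V (h.conjSubmodule s S) := by
  apply le_antisymm
  · rw [isotypicComponent, ← conjOrderIso_apply, OrderIso.map_sSup]
    refine iSup₂_le fun m hm ↦ ?_
    obtain ⟨e⟩ := hm
    change h.conjSubmodule s m ≤ isotypicComponent R V (h.conjSubmodule s S)
    exact le_sSup ⟨h.conjSubmoduleCongr s e⟩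
  · refine sSup_le fun m hm ↦ ?_
    obtain ⟨e⟩ := hm
    have e' : (h.conjSubmodule s⁻¹ m) ≃ₗ[R] S :=
      (h.conjSubmoduleCongr s⁻¹ e).trans (LinearEquiv.ofEq _ _ (h.conjSubmodule_inv_conjSubmodule s S))
    have hle : h.conjSubmodule s⁻¹ m ≤ isotypicComponent R V S := le_sSup ⟨e'⟩
    have hle' := h.conjSubmodule_mono s hle
    rwa [conjSubmodule_conjSubmodule_inv] at hle'

/-- **`s` permutes the isotypic components** ("`s𝒱_i = 𝒱_j`"): if `c` is an isotypic component of the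
`R`-module `V` (Mathlib `isotypicComponents R V`: the components `𝒱_S`, `S` a simple submodule), so is
`sc`. [cite: DolgachevZarhin2024, §2.3 proof of Theorem 2.21, Step 2] -/
theorem conjSubmodule_mem_isotypicComponents (h : IsNormalSubalgebra ρ R) (s : G) {c : Submodule R V}
    (hc : c ∈ isotypicComponents R V) : h.conjSubmodule s c ∈ isotypicComponents R V := by
  obtain ⟨S, hS, rfl⟩ := hc
  exact ⟨h.conjSubmodule s S, (h.isSimpleModule_conjSubmodule_iff s S).2 hS,
    h.conjSubmodule_isotypicComponent s S⟩

/-- **"This gives rise to the homomorphism `G → 𝐒_r`"**: the permutation action `s ↦ (𝒱_i ↦ s𝒱_i)` of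
`G` on the set of isotypic components of the `R`-module `V`.
[cite: DolgachevZarhin2024, §2.3 proof of Theorem 2.21, Step 2] -/
def isotypicComponentsPerm (h : IsNormalSubalgebra ρ R) : G →* Equiv.Perm (isotypicComponents R V) where
  toFun s :=
    { toFun := fun c ↦ ⟨h.conjSubmodule s c, h.conjSubmodule_mem_isotypicComponents s c.2⟩
      invFun := fun c ↦ ⟨h.conjSubmodule s⁻¹ c, h.conjSubmodule_mem_isotypicComponents s⁻¹ c.2⟩
      left_inv := fun c ↦ Subtype.ext (h.conjSubmodule_inv_conjSubmodule s c)
      right_inv := fun c ↦ Subtype.ext (h.conjSubmodule_conjSubmodule_inv s c) }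
  map_one' := Equiv.ext fun c ↦ Subtype.ext (h.conjSubmodule_one c)
  map_mul' s t := Equiv.ext fun c ↦ Subtype.ext (h.conjSubmodule_mul s t c)

/-- Unfolding of `isotypicComponentsPerm`: `s · 𝒱_i = s𝒱_i`.
[cite: DolgachevZarhin2024, §2.3 proof of Theorem 2.21, Step 2] -/
@[simp] theorem coe_isotypicComponentsPerm_apply (h : IsNormalSubalgebra ρ R) (s : G)
    (c : isotypicComponents R V) :
    ((h.isotypicComponentsPerm s c : isotypicComponents R V) : Submodule R V) = h.conjSubmodule s c := rfl

end CommRing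

/-! ### §4 Steps 1–2 for an irreducible `G`-module over a field -/

section Field

variable {k : Type*} [Field k] {G : Type*} [Group G] {V : Type*} [AddCommGroup V] [Module k V]
variable {ρ : Representation k G V} {R : Subalgebra k (Module.End k V)}

/-- An irreducible representation lives on a non-zero space (`0 ≠ V` in the lattice of
subrepresentations). [folklore] -/
private theorem nontrivial_of_isIrreducible [ρ.IsIrreducible] : Nontrivial V := by
  have hne : (⊥ : Subrepresentation ρ) ≠ ⊤ := bot_ne_top
  have hne' : (⊥ : Submodule k V) ≠ ⊤ := fun e ↦ hne (Subrepresentation.toSubmodule_injective e)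
  exact (Submodule.nontrivial_iff k).mp (nontrivial_of_ne _ _ hne')

/-- "`U' = Σ_{s ∈ G} sU` is a non-zero `G`-stable subspace in `𝒱` and therefore must coincide with `𝒱`":
for `ρ` irreducible and `U ≠ 0`, `Σ_s sU = V`. [cite: DolgachevZarhin2024, §2.3 proof of Theorem 2.21, Step 1] -/
theorem iSup_conjSubmodule_eq_top [ρ.IsIrreducible] (h : IsNormalSubalgebra ρ R) {U : Submodule R V}
    (hU : U ≠ ⊥) : ⨆ s, h.conjSubmodule s U = ⊤ := by
  rcases IsSimpleOrder.eq_bot_or_eq_top (h.iSupConjSubrepresentation U) with hb | ht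
  · exfalso
    apply hU
    have hb' : (⨆ s, h.conjSubmodule s U).restrictScalars k = ⊥ :=
      congrArg Subrepresentation.toSubmodule hb
    rw [Submodule.restrictScalars_eq_bot_iff] at hb'
    have hle := h.le_iSup_conjSubmodule U
    rw [hb'] at hle
    exact le_bot_iff.mp hle
  · have ht' : (⨆ s, h.conjSubmodule s U).restrictScalars k = ⊤ :=
      congrArg Subrepresentation.toSubmodule ht
    rwa [Submodule.restrictScalars_eq_top_iff] at ht'

/-- **Step 1.** Let `k` be a field, `G` a group, `ρ : G → Aut_k(V)` an irreducible representation on a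
finite-dimensional `V` and `R ⊂ End_k(V)` a `G`-normal subalgebra. Then `V` is a semisimple `R`-module:
a simple `R`-submodule `U` exists (`V ≠ 0` is Artinian over `k ⊂ R`), every `sU` is simple, and
`V = Σ_s sU`. [cite: DolgachevZarhin2024, §2.3 proof of Theorem 2.21, Step 1] -/
theorem isSemisimpleModule_of_isIrreducible [FiniteDimensional k V] [ρ.IsIrreducible]
    (h : IsNormalSubalgebra ρ R) : IsSemisimpleModule R V := by
  haveI : Nontrivial V := nontrivial_of_isIrreducible (ρ := ρ)
  haveI : IsArtinian R V := isArtinian_of_tower k inferInstance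
  haveI : IsAtomic (Submodule R V) := isAtomic_of_orderBot_wellFounded_lt wellFounded_lt
  obtain ⟨U, hU, -⟩ := (eq_bot_or_exists_atom_le (⊤ : Submodule R V)).resolve_left top_ne_bot
  haveI : ∀ s : G, IsSimpleModule R (h.conjSubmodule s U) := fun s ↦
    (h.isSimpleModule_conjSubmodule_iff s U).2 (isSimpleModule_iff_isAtom.2 hU)
  exact isSemisimpleModule_of_isSemisimpleModule_submodule' (fun s ↦ inferInstance)
    (h.iSup_conjSubmodule_eq_top hU.1)

/-- **Step 2, transitivity** ("since `𝒱` is simple `G`-module, `G` permutes them transitively"): for `ρ`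
irreducible, any two isotypic components `𝒱_i`, `𝒱_j` of the `R`-module `V` satisfy `s𝒱_i = 𝒱_j` for
some `s ∈ G` (otherwise `V = Σ_s s𝒱_i` would lie in the sum of the components other than `𝒱_j`, which
meets `𝒱_j` trivially). [cite: DolgachevZarhin2024, §2.3 proof of Theorem 2.21, Step 2] -/
theorem exists_conjSubmodule_eq [ρ.IsIrreducible] (h : IsNormalSubalgebra ρ R) {c c' : Submodule R V}
    (hc : c ∈ isotypicComponents R V) (hc' : c' ∈ isotypicComponents R V) :
    ∃ s : G, h.conjSubmodule s c = c' := by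
  by_contra hne
  have hne' : ∀ s : G, h.conjSubmodule s c ≠ c' := fun s hs ↦ hne ⟨s, hs⟩
  have hle : ⨆ s, h.conjSubmodule s c ≤ sSup (isotypicComponents R V \ {c'}) :=
    iSup_le fun s ↦ le_sSup ⟨h.conjSubmodule_mem_isotypicComponents s hc, hne' s⟩
  rw [h.iSup_conjSubmodule_eq_top (bot_lt_isotypicComponents hc).ne', top_le_iff] at hle
  have hdis := sSupIndep_isotypicComponents R V hc'
  rw [hle, disjoint_top] at hdis
  exact (bot_lt_isotypicComponents hc').ne' hdis

/-- **Step 2, transitivity** for the permutation representation `G → 𝐒_r`.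
[cite: DolgachevZarhin2024, §2.3 proof of Theorem 2.21, Step 2] -/
theorem isotypicComponentsPerm_transitive [ρ.IsIrreducible] (h : IsNormalSubalgebra ρ R)
    (c c' : isotypicComponents R V) : ∃ s : G, h.isotypicComponentsPerm s c = c' :=
  (h.exists_conjSubmodule_eq c.2 c'.2).imp fun _ hs ↦ Subtype.ext hs

/-- "`𝒱 = 𝒱_1 ⊕ ⋯ ⊕ 𝒱_r`": a finite-dimensional `V` has finitely many isotypic components as an
`R`-module (`R ⊂ End_k(V)` any subalgebra). [cite: DolgachevZarhin2024, §2.3 proof of Theorem 2.21, Step 2] -/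
theorem _root_.Literature.RepresentationTheory.isotypicComponents_finite [FiniteDimensional k V]
    (R : Subalgebra k (Module.End k V)) : (isotypicComponents R V).Finite := by
  haveI : IsNoetherian R V := isNoetherian_of_tower k inferInstance
  exact Set.toFinite _

/-- **"Dimension arguments imply that `r ≤ dim(𝒱)`"**: the number of isotypic components of `V` as an
`R`-module (`R ⊂ End_k(V)` any subalgebra) is at most `dim_k V` — they are independent non-zero
`k`-subspaces. [cite: DolgachevZarhin2024, §2.3 proof of Theorem 2.21, Step 2] -/
theorem _root_.Literature.RepresentationTheory.natCard_isotypicComponents_le_finrank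
    [FiniteDimensional k V] (R : Subalgebra k (Module.End k V)) :
    Nat.card (isotypicComponents R V) ≤ finrank k V := by
  haveI : IsNoetherian R V := isNoetherian_of_tower k inferInstance
  -- the components are independent as `R`-submodules, hence as `k`-subspaces
  have hR : iSupIndep fun c : isotypicComponents R V ↦ (c : Submodule R V) :=
    (sSupIndep_iff _).1 (sSupIndep_isotypicComponents R V)
  have hk : iSupIndep fun c : isotypicComponents R V ↦ (c : Submodule R V).restrictScalars k := by
    intro c
    have hc := hR c
    rw [disjoint_iff] at hc ⊢
    have hsup : (⨆ (j : isotypicComponents R V) (_ : j ≠ c), (j : Submodule R V).restrictScalars k) =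
        (⨆ (j : isotypicComponents R V) (_ : j ≠ c), (j : Submodule R V)).restrictScalars k := by
      simp only [Submodule.restrictScalars_iSup]
    rw [hsup, ← Submodule.restrictScalars_inf, hc, Submodule.restrictScalars_bot]
  -- and all non-zero
  have hne : ∀ c : isotypicComponents R V, (c : Submodule R V).restrictScalars k ≠ ⊥ := fun c ↦ by
    rw [ne_eq, Submodule.restrictScalars_eq_bot_iff]
    exact (bot_lt_isotypicComponents c.2).ne'
  haveI : Fintype {c : isotypicComponents R V // (c : Submodule R V).restrictScalars k ≠ ⊥} :=
    Fintype.ofFinite _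
  calc Nat.card (isotypicComponents R V)
      = Nat.card {c : isotypicComponents R V // (c : Submodule R V).restrictScalars k ≠ ⊥} :=
        Nat.card_congr (Equiv.subtypeUnivEquiv hne).symm
    _ = Fintype.card {c : isotypicComponents R V // (c : Submodule R V).restrictScalars k ≠ ⊥} :=
        Nat.card_eq_fintype_card
    _ ≤ finrank k V := hk.subtype_ne_bot_le_finrank

/-- **Step 2, conclusion** ("This means that `s𝒱_i = 𝒱_i` for all `s ∈ G`, and `𝒱 = 𝒱_i` is
isotypic"): for `ρ` irreducible, an isotypic component fixed by every `s ∈ G` is all of `V`, so the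
`R`-module `V` is isotypic (Mathlib `IsIsotypic`). [cite: DolgachevZarhin2024, §2.3 proof of Theorem 2.21, Step 2] -/
theorem isIsotypic_of_forall_conjSubmodule_eq [ρ.IsIrreducible] (h : IsNormalSubalgebra ρ R)
    {c : Submodule R V} (hc : c ∈ isotypicComponents R V) (hfix : ∀ s : G, h.conjSubmodule s c = c) :
    IsIsotypic R V := by
  obtain ⟨S, hS, rfl⟩ := hc
  haveI := hS
  have htop : isotypicComponent R V S = ⊤ := by
    have h1 := h.iSup_conjSubmodule_eq_top (bot_lt_isotypicComponent (R := R) (M := V) S).ne'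
    simpa only [hfix, iSup_const] using h1
  exact (IsIsotypicOfType.of_isotypicComponent_eq_top htop).isIsotypic

/-- **Step 2, conclusion** for the permutation representation: if `G → 𝐒_r` is trivial, the `R`-module
`V` is isotypic. [cite: DolgachevZarhin2024, §2.3 proof of Theorem 2.21, Step 2] -/
theorem isIsotypic_of_isotypicComponentsPerm_eq_one [FiniteDimensional k V] [ρ.IsIrreducible]
    (h : IsNormalSubalgebra ρ R) (htriv : h.isotypicComponentsPerm = 1) : IsIsotypic R V := by
  haveI : Nontrivial V := nontrivial_of_isIrreducible (ρ := ρ)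
  haveI := h.isSemisimpleModule_of_isIrreducible
  obtain ⟨S, hS⟩ := IsSemisimpleModule.exists_simple_submodule R V
  have hc : isotypicComponent R V S ∈ isotypicComponents R V := ⟨S, hS, rfl⟩
  refine h.isIsotypic_of_forall_conjSubmodule_eq hc fun s ↦ ?_
  have h1 := congrArg
    (fun f : G →* Equiv.Perm (isotypicComponents R V) ↦ ((f s ⟨_, hc⟩ : isotypicComponents R V) : Submodule R V))
    htriv
  simpa using h1

/-- **Step 2 as used in the text**: `k` a field, `G` a group, `ρ` irreducible on a finite-dimensional
`V`, `R ⊂ End_k(V)` a `G`-normal subalgebra. If every homomorphism `G → 𝐒_r` with `r ≤ dim_k(V)` is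
trivial (in the text: "`G` is a simple group, whose order is greater than `r!`"), then the `R`-module
`V` is isotypic. [cite: DolgachevZarhin2024, §2.3 proof of Theorem 2.21, Step 2] -/
theorem isIsotypic_of_forall_perm_hom_eq_one [FiniteDimensional k V] [ρ.IsIrreducible]
    (h : IsNormalSubalgebra ρ R)
    (hG : ∀ r : ℕ, r ≤ finrank k V → ∀ f : G →* Equiv.Perm (Fin r), f = 1) : IsIsotypic R V := by
  haveI : Finite (isotypicComponents R V) := (isotypicComponents_finite (k := k) R).to_subtype
  let e := Finite.equivFin (isotypicComponents R V)
  let f : G →* Equiv.Perm (Fin (Nat.card (isotypicComponents R V))) :=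
    e.permCongrHom.toMonoidHom.comp h.isotypicComponentsPerm
  have hf : f = 1 := hG _ (natCard_isotypicComponents_le_finrank (k := k) R) f
  refine h.isIsotypic_of_isotypicComponentsPerm_eq_one (MonoidHom.ext fun s ↦ ?_)
  rw [MonoidHom.one_apply]
  have hs : e.permCongrHom (h.isotypicComponentsPerm s) = 1 := by
    change f s = 1
    rw [hf, MonoidHom.one_apply]
  exact (map_eq_one_iff _ e.permCongrHom.injective).1 hs

end Field

end IsNormalSubalgebra

end Literature.RepresentationTheory
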